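import Mathlib
import Summits.MatrixMultiplication.MatrixMultiplication.Theorems.HyperoctahedralThreshold.Negative.SubgroupPivotSieve

/-!
# `SnSubsetDichotomy.HyperoctahedralSubsets`, line `spherical-rank-sieve` —
# stubs `stub_quotientSubgroupSieve` and `stub_quotientSubgroupCap`

Quotient-subgroup form of the subgroup-pivot sieve (crux `stmt-MatrixMultiplication-8305`,
registered stubs `stub_quotientSubgroupSieve` / `stub_quotientSubgroupCap` of the lead's skeleton
for line `spherical-rank-sieve`; the representation-theoretic second front).

* `stub_quotientSubgroupSieve` — if `(X 0, X 1, X 2)` is a TPP triple of subsets of `S_n` and the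
  right quotient set `Q(X 0) = {x x'⁻¹ : x, x' ∈ X 0}` CONTAINS a subgroup `H`, then
  `|H|·|X 1|·|X 2| ≤ n!·d_max(S_n)`.  The triple product property transfers from
  `(X 0, X 1, X 2)` to `(H, X 1, X 2)` (`QuotientSubgroupSieve.tpp_of_quotient_superset`:
  a relation `s s'⁻¹ · t t'⁻¹ · u u'⁻¹ = 1` with `s, s' ∈ H` has `s s'⁻¹ = x x'⁻¹` for some
  `x, x' ∈ X 0`, and TPP of the original triple at `(x, x', t, t', u, u')` forces `x = x'`,
  hence `s = s'`, and `t = t'`, `u = u'`), and then the tree's subgroup-pivot sieve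
  `HyperoctahedralThreshold.Negative.sieve` applies with `|S_n| = n!`.
* `stub_quotientSubgroupCap` — the Vershik–Kerov corollary (template:
  `HyperoctahedralThreshold.Negative.conceded_subgroup_cap`): with
  `VershikKerov1985_maxCharDegree_holds` at `ε = c₂/2` (`c₂ = vkUpperConst`), for `n ≥ n₀`,
  `|H|·(|X 0||X 1||X 2|) ≤ |X 0|·(n!)^{3/2}·e^{-(c₂/2)√n}`.
-/

set_option linter.dupNamespace false

namespace Summit.MatrixMultiplication.MatrixMultiplication.Theorems.HyperoctahedralSubsets

open Literature.Combinatorics.Additive Literature.RepresentationTheory.FiniteGroups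

namespace QuotientSubgroupSieve

/-- **TPP transfer to a subgroup of the quotient set.** If `(X₀, X₁, X₂)` has the triple product
property and every element of the subgroup `H` is a right quotient `x x'⁻¹` of two elements of
`X₀`, then `(S, X₁, X₂)` has the triple product property for every finset `S` contained in `H`.
[folklore] -/
theorem tpp_of_quotient_superset {G : Type*} [Group G] (H : Subgroup G)
    (S X₀ X₁ X₂ : Finset G) (hS : ∀ x ∈ S, x ∈ H)
    (hQ : ∀ h ∈ H, ∃ x ∈ X₀, ∃ x' ∈ X₀, h = x * x'⁻¹)
    (hT : TripleProductProperty X₀ X₁ X₂) : TripleProductProperty S X₁ X₂ := by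
  intro s hs s' hs' t ht t' ht' u hu u' hu' h1
  obtain ⟨x, hx, x', hx', hxx⟩ :=
    hQ (s * s'⁻¹) (H.mul_mem (hS _ hs) (H.inv_mem (hS _ hs')))
  obtain ⟨rfl, htt, huu⟩ := hT x hx x' hx' t ht t' ht' u hu u' hu' (by rw [← hxx]; exact h1)
  refine ⟨?_, htt, huu⟩
  rw [mul_inv_cancel] at hxx
  exact mul_inv_eq_one.mp hxx

/-- `|S_n| = n!` for `S_n = Equiv.Perm (Fin n)`, in `Nat.card` form. [folklore] -/
theorem natCard_perm_fin (n : ℕ) : Nat.card (Equiv.Perm (Fin n)) = n.factorial := by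
  rw [Nat.card_eq_fintype_card, Fintype.card_perm, Fintype.card_fin]

end QuotientSubgroupSieve

open QuotientSubgroupSieve in
/-- **Stub `stub_quotientSubgroupSieve` — quotient-subgroup pivot sieve** (line
`spherical-rank-sieve` of crux `SnSubsetDichotomy.HyperoctahedralSubsets`,
stmt-MatrixMultiplication-8305).  For a TPP triple `(X 0, X 1, X 2)` of subsets of `S_n` and a
subgroup `H` contained in the right quotient set `Q(X 0) = {x x'⁻¹ : x, x' ∈ X 0}`,
`|H|·|X 1|·|X 2| ≤ n!·d_max(S_n)`: TPP transfers to `(H, X 1, X 2)`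
(`QuotientSubgroupSieve.tpp_of_quotient_superset`) and the tree's subgroup-pivot sieve
`HyperoctahedralThreshold.Negative.sieve` applies. [this work] -/
theorem stub_quotientSubgroupSieve : ∀ (n : ℕ) (H : Subgroup (Equiv.Perm (Fin n))) (X : Fin 3 → Finset (Equiv.Perm (Fin n))), (∀ h ∈ H, ∃ x ∈ X 0, ∃ x' ∈ X 0, h = x * x'⁻¹) → Literature.Combinatorics.Additive.TripleProductProperty (X 0) (X 1) (X 2) → Nat.card H * (X 1).card * (X 2).card ≤ n.factorial * Literature.RepresentationTheory.FiniteGroups.maxCharDegree (Equiv.Perm (Fin n)) := by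
  intro n H X hQ hT
  classical
  have hT' : TripleProductProperty (Finset.univ.filter (· ∈ H)) (X 1) (X 2) :=
    tpp_of_quotient_superset H _ (X 0) (X 1) (X 2) (fun x hx => by simpa using hx) hQ hT
  have key := HyperoctahedralThreshold.Negative.sieve H (Finset.univ.filter (· ∈ H)) (X 1) (X 2)
    (fun x => by simp) hT'
  rwa [natCard_perm_fin] at key

open QuotientSubgroupSieve in
/-- **Stub `stub_quotientSubgroupCap` — quotient-subgroup cap in `S_n`** (line
`spherical-rank-sieve` of crux `SnSubsetDichotomy.HyperoctahedralSubsets`,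
stmt-MatrixMultiplication-8305).  With the tree's Vershik–Kerov theorem
(`VershikKerov1985_maxCharDegree_holds`, `ε := c₂/2`, `c₂ = vkUpperConst`): for `n ≥ n₀`, every
TPP triple `(X 0, X 1, X 2)` of subsets of `S_n` and every subgroup `H ⊆ Q(X 0)` satisfy
`|H|·(|X 0||X 1||X 2|) = |X 0|·(|H||X 1||X 2|) ≤ |X 0|·n!·d_max(S_n) ≤ |X 0|·(n!)^{3/2}·e^{-(c₂/2)√n}`
(`stub_quotientSubgroupSieve` multiplied by `|X 0|`). [this work] -/
theorem stub_quotientSubgroupCap : ∃ n₀ : ℕ, ∀ n ≥ n₀, ∀ (H : Subgroup (Equiv.Perm (Fin n))) (X : Fin 3 → Finset (Equiv.Perm (Fin n))), (∀ h ∈ H, ∃ x ∈ X 0, ∃ x' ∈ X 0, h = x * x'⁻¹) → Literature.Combinatorics.Additive.TripleProductProperty (X 0) (X 1) (X 2) → (Nat.card H : ℝ) * (((X 0).card * (X 1).card * (X 2).card : ℕ) : ℝ) ≤ ((X 0).card : ℝ) * (n.factorial : ℝ) ^ ((3 : ℝ) / 2) * Real.exp (-(Literature.RepresentationTheory.FiniteGroups.vkUpperConst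 / 2 * Real.sqrt (n : ℝ))) := by
  have hc := vkUpperConst_pos
  obtain ⟨n₀, hn₀⟩ := VershikKerov1985_maxCharDegree_holds (vkUpperConst / 2) (by linarith)
  refine ⟨n₀, fun n hn H X hQ hT => ?_⟩
  have hnat := stub_quotientSubgroupSieve n H X hQ hT
  have hnat' : (X 0).card * (Nat.card H * (X 1).card * (X 2).card) ≤
      (X 0).card * (n.factorial * maxCharDegree (Equiv.Perm (Fin n))) :=
    Nat.mul_le_mul_left _ hnat
  have hreal : ((X 0).card : ℝ) * ((Nat.card H : ℝ) * ((X 1).card : ℝ) * ((X 2).card : ℝ)) ≤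
      ((X 0).card : ℝ) * ((n.factorial : ℝ) * (maxCharDegree (Equiv.Perm (Fin n)) : ℝ)) := by
    exact_mod_cast hnat'
  have hVK := (show vkUpperConst - vkUpperConst / 2 = vkUpperConst / 2 by ring) ▸ (hn₀ n hn).2
  have hF : (0 : ℝ) ≤ (n.factorial : ℝ) := Nat.cast_nonneg _
  have hX0 : (0 : ℝ) ≤ ((X 0).card : ℝ) := Nat.cast_nonneg _
  -- `(n!)^{3/2} = n! · √(n!)` (as in `HyperoctahedralThreshold.Negative.conceded_subgroup_cap`)
  have hpow : (n.factorial : ℝ) ^ ((3 : ℝ) / 2) = (n.factorial : ℝ) * Real.sqrt (n.factorial : ℝ) := by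
    rw [show ((3 : ℝ) / 2) = 1 + (1 / 2 : ℝ) by norm_num, Real.rpow_add' hF (by norm_num),
      Real.rpow_one, Real.sqrt_eq_rpow]
  calc (Nat.card H : ℝ) * (((X 0).card * (X 1).card * (X 2).card : ℕ) : ℝ)
      = ((X 0).card : ℝ) * ((Nat.card H : ℝ) * ((X 1).card : ℝ) * ((X 2).card : ℝ)) := by
        push_cast; ring
    _ ≤ ((X 0).card : ℝ) * ((n.factorial : ℝ) * (maxCharDegree (Equiv.Perm (Fin n)) : ℝ)) := hreal
    _ ≤ ((X 0).card : ℝ) * ((n.factorial : ℝ) * (Real.sqrt (n.factorial : ℝ) *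
          Real.exp (-(vkUpperConst / 2 * Real.sqrt (n : ℝ))))) :=
        mul_le_mul_of_nonneg_left (mul_le_mul_of_nonneg_left hVK hF) hX0
    _ = ((X 0).card : ℝ) * (n.factorial : ℝ) ^ ((3 : ℝ) / 2) *
          Real.exp (-(vkUpperConst / 2 * Real.sqrt (n : ℝ))) := by
        rw [hpow]; ring

end Summit.MatrixMultiplication.MatrixMultiplication.Theorems.HyperoctahedralSubsets
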